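/-
Copyright (c) 2026 the pub-hodgecm-mathlib formalisation cell (harness21).  Prover seat hodgecm-mathlib-K2E3-p11 (g3), Track B «K2-LIT» ∕ h413,
line `K2_E3_EllipticInputs`, unit U12 «Characters», socket #11 `sig_K2E3CharLocIntNearSemisimple`, road (11-PS) «by class: principal series».
FILE 1 of the road: CLASS FUNCTIONS ON THE HYPERBOLIC SET OF `U(Φ₃)(L⁺_v)` FROM `W`-SYMMETRIC FUNCTIONS ON THE SPLIT TORUS.  2026-09-04.
-/
import Summits.HodgeConjecture.HodgeConjecture.Theorems.F0P3cStCharTSWeylHypMeasure         -- ★ (LH2-p02) brings ★ WeylHypCM ∕ Torsor ∕ Fibre: `fibre_dichotomy`, `centralizer_eq_cmTorus_of_isRegularElt`, `isOpen_setOf_isRegularElt_torusU`, `isUnit_of_ne_zero_of_nonsplit`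
import Summits.HodgeConjecture.HodgeConjecture.Theorems.F0P3cStCharTSTorusDefs              -- ★ (LH6-p01) `hyperbolicSet` (the regular hyperbolic set `Ω`), `Gqs`
import Summits.HodgeConjecture.HodgeConjecture.Theorems.K2E3RegularConjugationOpenNonsplit  -- ★ (K2E3-p09) `conj_torus_mem_nhds_of_isRegularElt` (Harish-Chandra's openness at a regular point)
import Literature.NumberTheory.Automorphic.UnitaryGroupCMLocalIwasawa                       -- ★ `exists_mem_cmLocalIntegralLevel_mul_borel` (`G = K_v · B`)
import Literature.NumberTheory.Automorphic.CMPrincipalSeriesJacquetEvalOne                  -- ★ `continuous_proj_borelTriple`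
import Literature.NumberTheory.Automorphic.CMBorelWeylTorusConjugate                        -- ★ `weylConj_mem_cmTorus`
import Literature.NumberTheory.Automorphic.LocalUnitaryGroupCongr                            -- ★ `isUnit_antidiagOne_det`
import HarnessLib

/-!
# K2_E3 road (h413 = stmt-HodgeConjecture-24833), unit U12 «Characters», socket #11 — road (11-PS) «BY CLASS: PRINCIPAL SERIES», FILE 1:
# a continuous `W`-symmetric function on the split torus `T` of `G = U(Φ₃)(L⁺_v)` (`v` non-split) extends to a MEASURABLE CLASS FUNCTION on `G`,
# equal to it on `T^{reg}`, supported in the regular hyperbolic set `Ω`, bounded on compact sets (Rogawski 1990 §12.5 p. 182; Harish-Chandra 1970 Lemmas 19–20, 42)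

Cell `pub/hodgecm-mathlib` (D-0151), Track B (21-frontier RULING «PUSH BOTH» 2026-09-03), `--supports stmt-HodgeConjecture-24833 --as helper` (count-neutral);
THEOREMS ONLY — no `def`, no instance, no notation, no named fact, no `sorry`; ★-only imports.  Seat K2E3-p11 (g3), default self-deal (11-PS) (squad bus
2026-09-04T00:51Z).

THE POINT.  The character of the principal series `i_G(χ)` of `G = U(Φ₃)(L⁺_v)` is the class function `Θ_χ = (χ + χ ∘ ʷ)∕D_G` on the regular hyperbolic set
`Ω = ⋃_x x T^{reg} x⁻¹` and `0` off it [Rogawski1990, (4.9.4) p. 56, §12.5 p. 182; vanDijk1972].  To realise `Θ_χ` as an honest MEASURABLE, LOCALLY BOUNDED (numerator)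
function on `G` one needs: (a) a regular `t ∈ T` is conjugate to `t′ ∈ T` only if `t′ ∈ {t, ʷt}` (★ `fibre_dichotomy`, [HarishChandra1970, L. 42]); (b) Harish-Chandra's
openness «conjugates of nearby torus points by arbitrary elements form a neighbourhood of a regular `γ₀`» (★ K2E3-p09 `conj_torus_mem_nhds_of_isRegularElt`,
[HarishChandra1970, Part I §3 L. 20]); (c) Iwasawa `G = K_v B` and the continuity of the Levi projection `B → T` (★), which bound the torus parameters of the classes
meeting a compact set [HarishChandra1970, Part I §3 L. 19, Cor.].  Given a continuous `ψ : T → ℂ` with `ψ(ʷt) = ψ(t)`, the extension is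
`N_ψ(x) = ψ(t_x)` for `x ∈ Ω` (`t_x ∈ T^{reg}` any torus conjugate of `x`, by choice) and `0` off `Ω`:
* §1 `weylConj_weylConj_eq` (`ʷ(ʷt) = t`), `eq_or_eq_weylConj_of_isConj` ((a) in `IsConj` form);
* §2 `conj_regular_torus_nhds` (the (b)-neighbourhoods: for `γ₀ = c t₀ c⁻¹ ∈ Ω` and `V ∈ 𝓝 t₀` in `T`, `{x s x⁻¹ : s ∈ V ∩ T^{reg}} ∈ 𝓝 γ₀`), **`isOpen_hyperbolicSet`**;
* §3 for ANY `N` agreeing with the recipe (`hN`, `hN0`): `apply_eq_of_isConj` (`N x = ψ t` whenever `t ∈ T^{reg}` is conjugate to `x`), conjugation invariance,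
  `continuousAt_of_mem` (continuity at the points of `Ω`), **`measurable_of_recipe`**, **`exists_bound_of_isCompact`** ((c): `‖N‖ ≤ B` on a compact `K`);
* §4 the package **`exists_hyperbolicClassFun`**: `∃ N : G → ℂ`, measurable, conjugation invariant on `Ω`, `= 0` off `Ω`, `N t = ψ t` on `T^{reg}`, bounded on compacts.
FILE 3 of the road multiplies `N_{χ + χ∘ʷ}` by `|D_G|^{−1∕2}` (★ HC-D `locallyIntegrable_weylDiscr_inv`) to obtain `Θ_χ ∈ L¹_loc`.

HONEST LABEL: HC_CM is proved only modulo the 7 printed citations (2 remaining named inputs: hLiu418 = stmt-HodgeConjecture-24832, h413 = stmt-HodgeConjecture-24833)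
until rung 0 closes; count-neutral helper (row #11 stays OPEN; this is structure for its (11-PS) road).

## References
* [Rogawski1990] J. D. Rogawski, *Automorphic Representations of Unitary Groups in Three Variables*, Ann. of Math. Stud. 123 (1990), §12.5 p. 182 (the hyperbolic
  part of `G^r`, `|W(T)| = 2`), §4.9 (4.9.4) p. 56, §1.10 p. 9.
* [HarishChandra1970] Harish-Chandra (notes by G. van Dijk), *Harmonic Analysis on Reductive p-adic Groups*, LNM 162 (1970), Part I §3 Lemma 19 (Cor.), Lemma 20;
  Part V §3 Theorem 12 (the character as a class function built from its torus values); Lemma 42.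
* [vanDijk1972] G. van Dijk, *Computation of certain induced characters of 𝔭-adic groups*, Math. Ann. 199 (1972), §2, Thm. p. 237.
-/

set_option autoImplicit false
-- the mandated namespace has the single-problem summit's repeated segment (`HodgeConjecture.HodgeConjecture`)
set_option linter.dupNamespace false

noncomputable section

open Set Filter Topology NumberField IsDedekindDomain
open Literature.NumberTheory.Automorphic Literature.NumberTheory.Automorphic.UnitaryGroup Literature.NumberTheory.Rogawski1990
open Summit.HodgeConjecture.HodgeConjecture.Cruxes.H413.F0P3cStCharTSTorusDefs
open Summit.HodgeConjecture.HodgeConjecture.Cruxes.H413.F0P3cStCharTSWeylHypTorsor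
open Summit.HodgeConjecture.HodgeConjecture.Cruxes.H413.F0P3cStCharTSWeylHypFibre
open Summit.HodgeConjecture.HodgeConjecture.Cruxes.H413.F0P3cStCharTSWeylHypCM
open Summit.HodgeConjecture.HodgeConjecture.Cruxes.H413.F0P3cStCharTSWeylHypMeasure
open scoped MatrixGroups

namespace Summit.HodgeConjecture.HodgeConjecture.Cruxes.H413.K2E3HyperbolicClassFunOfTorus

variable (L : Type) [Field L] [NumberField L] [IsCMField L] (v : HeightOneSpectrum (𝓞 ↥(maximalRealSubfield L)))

/-! ## §1 The Weyl involution on the split torus and the `W`-rigidity of conjugate regular torus elements -/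

/-- **`ʷ(ʷt) = t`** for `t` in the split torus `T` of `U(Φ₃)(L⁺_v)` and `w₀` the element with matrix `Φ₃`: `w₀²` is diagonal (anti-diagonal × anti-diagonal, ★
`weyl_mul_mem_torusU_of_antidiag`) and `T` is abelian (★ `mul_comm_of_mem_torusU_cmLocal`). [cite: Rogawski1990, §1.10 p. 9; §12.2 p. 173] -/
theorem weylConj_weylConj_eq
    (w₀ : ↥(unitaryGroupOfForm (conjLocal L (IsCMField.complexConj L) v) (cmLocalForm L 3 v)))
    (hw₀ : Units.val (w₀ : GL (Fin 3) (LocalRing L v)) = cmLocalForm L 3 v)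
    {t : ↥(unitaryGroupOfForm (conjLocal L (IsCMField.complexConj L) v) (cmLocalForm L 3 v))} (ht : t ∈ (cmBorelTriple L 3 v).M) :
    w₀ * (w₀ * t * w₀⁻¹) * w₀⁻¹ = t := by
  have hww : w₀ * w₀ ∈ torusU (conjLocal L (IsCMField.complexConj L) v) (cmLocalForm L 3 v) :=
    weyl_mul_mem_torusU_of_antidiag (conjLocal L (IsCMField.complexConj L) v) (cmLocalForm_eq_over L 3 v) hw₀
      (fun i j hij => weyl_apply_eq_zero (conjLocal L (IsCMField.complexConj L) v) (cmLocalForm_eq_over L 3 v) hw₀ i j hij)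
  have hcomm := mul_comm_of_mem_torusU_cmLocal L v hww ht
  calc w₀ * (w₀ * t * w₀⁻¹) * w₀⁻¹ = (w₀ * w₀) * t * (w₀ * w₀)⁻¹ := by group
    _ = t * (w₀ * w₀) * (w₀ * w₀)⁻¹ := by rw [hcomm]
    _ = t := by rw [mul_inv_cancel_right]

/-- **`W`-RIGIDITY OF CONJUGATE REGULAR TORUS ELEMENTS** (`v` non-split): if `t, t′ ∈ T^{reg}` are conjugate in `U(Φ₃)(L⁺_v)`, then `t′ = t` or `t′ = ʷt` — ★
`fibre_dichotomy` (the fibres of `U∕T × T^{reg} → Ω` are `N(T)∕T`-torsors, `|N(T)∕T| = 2`) read in `IsConj` form. [cite: Rogawski1990, §12.5 p. 182]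
[cite: HarishChandra1970, Lemma 42] [cite: vanDijk1972, §2] -/
theorem eq_or_eq_weylConj_of_isConj (hns : ∀ w : PlacesOver L v, IsCMField.complexConj L • w.1 = w.1)
    (w₀ : ↥(unitaryGroupOfForm (conjLocal L (IsCMField.complexConj L) v) (cmLocalForm L 3 v)))
    (hw₀ : Units.val (w₀ : GL (Fin 3) (LocalRing L v)) = cmLocalForm L 3 v)
    {t t' : ↥(unitaryGroupOfForm (conjLocal L (IsCMField.complexConj L) v) (cmLocalForm L 3 v))}
    (ht : t ∈ (cmBorelTriple L 3 v).M) (hreg : IsRegularElt (t : GL (Fin 3) (LocalRing L v)))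
    (ht' : t' ∈ (cmBorelTriple L 3 v).M) (hreg' : IsRegularElt (t' : GL (Fin 3) (LocalRing L v)))
    (h : IsConj t t') : t' = t ∨ t' = w₀ * t * w₀⁻¹ := by
  haveI : Nontrivial (LocalRing L v) := UnitaryGroup.nontrivial_localRing L v
  obtain ⟨c, hc⟩ := isConj_iff.1 h
  have h' : c * t * c⁻¹ = 1 * t' * 1⁻¹ := by rw [hc, one_mul, inv_one, mul_one]
  rcases fibre_dichotomy (conjLocal L (IsCMField.complexConj L) v) (isUnit_of_ne_zero_of_nonsplit L v hns) (cmLocalForm_eq_over L 3 v) hw₀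
      ht' hreg' ht hreg h' with ⟨-, h1⟩ | ⟨-, h2⟩
  · exact Or.inl h1.symm
  · right
    rw [h2, weylConj_weylConj_eq L v w₀ hw₀ ht']

/-! ## §2 Harish-Chandra's openness at the points of `Ω`; `Ω` is open -/

/-- ★ K2E3-p09's openness lemma `conj_torus_mem_nhds_of_isRegularElt` READ ON THE MATRIX CARRIER of `U(Φ₃)(L⁺_v)` (`H = Φ₃`, `det Φ₃` a unit; the carrier
`(cmDatum L 3 Φ₃).Local v` IS `↥(unitaryGroupOfForm (c ⊗ 1) (cmLocalForm L 3 v))`, ★ `cmDatum_Local_eq`): for a regular `γ₀` and neighbourhoods `W ∋ 1`, `O ∋ γ₀`,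
`{x t x⁻¹ : x ∈ W, t ∈ Z(γ₀) ∩ O} ∈ 𝓝 γ₀`. [cite: HarishChandra1970, Part I §3 Lemma 20] [cite: HarishChandra1999, §18 p. 79] -/
theorem conj_torus_mem_nhds (hns : ∀ w : PlacesOver L v, IsCMField.complexConj L • w.1 = w.1)
    (γ₀ : ↥(unitaryGroupOfForm (conjLocal L (IsCMField.complexConj L) v) (cmLocalForm L 3 v))) (hγ₀ : IsRegularElt ((γ₀ : ↥(unitaryGroupOfForm (conjLocal L (IsCMField.complexConj L) v) (cmLocalForm L 3 v))) : GL (Fin 3) (LocalRing L v)))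
    {W : Set ↥(unitaryGroupOfForm (conjLocal L (IsCMField.complexConj L) v) (cmLocalForm L 3 v))} (hW : W ∈ 𝓝 (1 : ↥(unitaryGroupOfForm (conjLocal L (IsCMField.complexConj L) v) (cmLocalForm L 3 v))))
    {O : Set ↥(unitaryGroupOfForm (conjLocal L (IsCMField.complexConj L) v) (cmLocalForm L 3 v))} (hO : O ∈ 𝓝 γ₀) :
    {g : ↥(unitaryGroupOfForm (conjLocal L (IsCMField.complexConj L) v) (cmLocalForm L 3 v)) | ∃ x ∈ W, ∃ t : ↥(Subgroup.centralizer ({γ₀} : Set ↥(unitaryGroupOfForm (conjLocal L (IsCMField.complexConj L) v) (cmLocalForm L 3 v)))),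
      (t : ↥(unitaryGroupOfForm (conjLocal L (IsCMField.complexConj L) v) (cmLocalForm L 3 v))) ∈ O ∧ g = x * (t : ↥(unitaryGroupOfForm (conjLocal L (IsCMField.complexConj L) v) (cmLocalForm L 3 v))) * x⁻¹} ∈ 𝓝 γ₀ := by
  obtain ⟨w⟩ := (inferInstance : Nonempty (PlacesOver L v))
  exact K2E3RegularConjugationOpenNonsplit.conj_torus_mem_nhds_of_isRegularElt L (qsForm L) (isUnit_antidiagOne_det L 3) w (hns w) γ₀ hγ₀ hW hO

/-- **THE BASIC NEIGHBOURHOODS OF A POINT OF `Ω`.**  Let `γ₀ = c t₀ c⁻¹` with `t₀ ∈ T^{reg}` and let `V ∈ 𝓝 t₀` (in `T`).  Then the conjugates `x s x⁻¹` (`x ∈ G`, `s ∈ V`,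
`s` regular) form a NEIGHBOURHOOD of `γ₀` in `G = U(Φ₃)(L⁺_v)` (`v` non-split) — ★ `conj_torus_mem_nhds_of_isRegularElt` at `γ₀` (whose centraliser is `c T c⁻¹`, ★
`centralizer_eq_cmTorus_of_isRegularElt`) with the open set `O = c U₀ c⁻¹`, `U₀ ∩ T ⊆ V ∩ T^{reg}` (`T^{reg}` is open in `T`, ★ `isOpen_setOf_isRegularElt_torusU`).
[cite: HarishChandra1970, Part I §3 Lemma 20] [cite: Rogawski1990, §12.5 p. 182] -/
theorem conj_regular_torus_nhds (hns : ∀ w : PlacesOver L v, IsCMField.complexConj L • w.1 = w.1)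
    (t₀ : ↥(cmBorelTriple L 3 v).M)
    (hreg₀ : IsRegularElt (((t₀ : ↥(unitaryGroupOfForm (conjLocal L (IsCMField.complexConj L) v) (cmLocalForm L 3 v))) : GL (Fin 3) (LocalRing L v))))
    (c : ↥(unitaryGroupOfForm (conjLocal L (IsCMField.complexConj L) v) (cmLocalForm L 3 v)))
    {V : Set ↥(cmBorelTriple L 3 v).M} (hV : V ∈ 𝓝 t₀) :
    {g : ↥(unitaryGroupOfForm (conjLocal L (IsCMField.complexConj L) v) (cmLocalForm L 3 v)) |
        ∃ (x : ↥(unitaryGroupOfForm (conjLocal L (IsCMField.complexConj L) v) (cmLocalForm L 3 v))) (s : ↥(cmBorelTriple L 3 v).M), s ∈ V ∧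
          IsRegularElt (((s : ↥(unitaryGroupOfForm (conjLocal L (IsCMField.complexConj L) v) (cmLocalForm L 3 v))) : GL (Fin 3) (LocalRing L v))) ∧
          g = x * (s : ↥(unitaryGroupOfForm (conjLocal L (IsCMField.complexConj L) v) (cmLocalForm L 3 v))) * x⁻¹} ∈
      𝓝 (c * (t₀ : ↥(unitaryGroupOfForm (conjLocal L (IsCMField.complexConj L) v) (cmLocalForm L 3 v))) * c⁻¹) := by
  haveI : Nontrivial (LocalRing L v) := UnitaryGroup.nontrivial_localRing L v
  have hR := isUnit_of_ne_zero_of_nonsplit L v hns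
  -- shrink `V` to an open subset of `T^{reg}`, and write it as the trace of an open `U₀ ⊆ G`
  have hregO : IsOpen {t : ↥(cmBorelTriple L 3 v).M |
      IsRegularElt (((t : ↥(unitaryGroupOfForm (conjLocal L (IsCMField.complexConj L) v) (cmLocalForm L 3 v))) : GL (Fin 3) (LocalRing L v)))} :=
    isOpen_setOf_isRegularElt_torusU (conjLocal L (IsCMField.complexConj L) v) (cmLocalForm L 3 v) hR
  have hV' : V ∩ {t : ↥(cmBorelTriple L 3 v).M |
      IsRegularElt (((t : ↥(unitaryGroupOfForm (conjLocal L (IsCMField.complexConj L) v) (cmLocalForm L 3 v))) : GL (Fin 3) (LocalRing L v)))} ∈ 𝓝 t₀ :=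
    inter_mem hV (hregO.mem_nhds hreg₀)
  obtain ⟨OM, hOMsub, hOMopen, ht₀OM⟩ := mem_nhds_iff.1 hV'
  obtain ⟨U₀, hU₀open, hU₀eq⟩ := isOpen_induced_iff.1 hOMopen
  -- the open set `O = c U₀ c⁻¹ ∋ γ₀`
  set γ₀ : ↥(unitaryGroupOfForm (conjLocal L (IsCMField.complexConj L) v) (cmLocalForm L 3 v)) :=
    c * (t₀ : ↥(unitaryGroupOfForm (conjLocal L (IsCMField.complexConj L) v) (cmLocalForm L 3 v))) * c⁻¹ with hγ₀
  have hconjc : Continuous fun g : ↥(unitaryGroupOfForm (conjLocal L (IsCMField.complexConj L) v) (cmLocalForm L 3 v)) => c⁻¹ * g * c := by fun_prop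
  have hOopen : IsOpen ((fun g : ↥(unitaryGroupOfForm (conjLocal L (IsCMField.complexConj L) v) (cmLocalForm L 3 v)) => c⁻¹ * g * c) ⁻¹' U₀) :=
    hU₀open.preimage hconjc
  have ht₀U₀ : Subtype.val t₀ ∈ U₀ := by
    have h1 : t₀ ∈ Subtype.val ⁻¹' U₀ := hU₀eq ▸ ht₀OM
    exact Set.mem_preimage.1 h1
  have hγ₀O : γ₀ ∈ (fun g : ↥(unitaryGroupOfForm (conjLocal L (IsCMField.complexConj L) v) (cmLocalForm L 3 v)) => c⁻¹ * g * c) ⁻¹' U₀ := by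
    refine Set.mem_preimage.2 ?_
    have he : c⁻¹ * γ₀ * c = Subtype.val t₀ := by rw [hγ₀]; group
    rw [he]; exact ht₀U₀
  -- `γ₀` is regular; Harish-Chandra's openness at `γ₀`
  have hγ₀reg : IsRegularElt ((γ₀ : ↥(unitaryGroupOfForm (conjLocal L (IsCMField.complexConj L) v) (cmLocalForm L 3 v))) : GL (Fin 3) (LocalRing L v)) := by
    rw [hγ₀]; exact (isRegularElt_coe_conj_iff _ _ c _).2 hreg₀
  have hopen := conj_torus_mem_nhds L v hns γ₀ hγ₀reg (W := univ) univ_mem (hOopen.mem_nhds hγ₀O)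
  refine mem_of_superset hopen ?_
  rintro g ⟨x, -, t, htO, rfl⟩
  -- `s₀ := c⁻¹ t c` lies in `Z(t₀) = T`, in `U₀`, hence in `V ∩ T^{reg}`
  have htc : γ₀ * (t : ↥(unitaryGroupOfForm (conjLocal L (IsCMField.complexConj L) v) (cmLocalForm L 3 v))) = (t : ↥(unitaryGroupOfForm (conjLocal L (IsCMField.complexConj L) v) (cmLocalForm L 3 v))) * γ₀ :=
    (Subgroup.mem_centralizer_iff.1 t.2) γ₀ (mem_singleton γ₀)
  have hs₀Z : c⁻¹ * (t : ↥(unitaryGroupOfForm (conjLocal L (IsCMField.complexConj L) v) (cmLocalForm L 3 v))) * c ∈ Subgroup.centralizer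
      ({(t₀ : ↥(unitaryGroupOfForm (conjLocal L (IsCMField.complexConj L) v) (cmLocalForm L 3 v)))} : Set ↥(unitaryGroupOfForm (conjLocal L (IsCMField.complexConj L) v) (cmLocalForm L 3 v))) := by
    rw [Subgroup.mem_centralizer_iff]
    intro h hh
    rw [mem_singleton_iff.1 hh]
    have ht₀c : (t₀ : ↥(unitaryGroupOfForm (conjLocal L (IsCMField.complexConj L) v) (cmLocalForm L 3 v))) = c⁻¹ * γ₀ * c := by rw [hγ₀]; group
    rw [ht₀c]
    calc c⁻¹ * γ₀ * c * (c⁻¹ * (t : ↥(unitaryGroupOfForm (conjLocal L (IsCMField.complexConj L) v) (cmLocalForm L 3 v))) * c) = c⁻¹ * (γ₀ * (t : ↥(unitaryGroupOfForm (conjLocal L (IsCMField.complexConj L) v) (cmLocalForm L 3 v)))) * c := by group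
      _ = c⁻¹ * ((t : ↥(unitaryGroupOfForm (conjLocal L (IsCMField.complexConj L) v) (cmLocalForm L 3 v))) * γ₀) * c := by rw [htc]
      _ = c⁻¹ * (t : ↥(unitaryGroupOfForm (conjLocal L (IsCMField.complexConj L) v) (cmLocalForm L 3 v))) * c * (c⁻¹ * γ₀ * c) := by group
  rw [centralizer_eq_cmTorus_of_isRegularElt L v t₀.2 hreg₀] at hs₀Z
  have hs₀OM : (⟨c⁻¹ * (t : ↥(unitaryGroupOfForm (conjLocal L (IsCMField.complexConj L) v) (cmLocalForm L 3 v))) * c, hs₀Z⟩ : ↥(cmBorelTriple L 3 v).M) ∈ OM := by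
    rw [← hU₀eq]; exact htO
  obtain ⟨hs₀V, hs₀reg⟩ := hOMsub hs₀OM
  refine ⟨x * c, ⟨c⁻¹ * (t : ↥(unitaryGroupOfForm (conjLocal L (IsCMField.complexConj L) v) (cmLocalForm L 3 v))) * c, hs₀Z⟩, hs₀V, hs₀reg, ?_⟩
  show x * (t : ↥(unitaryGroupOfForm (conjLocal L (IsCMField.complexConj L) v) (cmLocalForm L 3 v))) * x⁻¹ = x * c * (c⁻¹ * (t : ↥(unitaryGroupOfForm (conjLocal L (IsCMField.complexConj L) v) (cmLocalForm L 3 v))) * c) * (x * c)⁻¹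
  group

/-- **THE REGULAR HYPERBOLIC SET `Ω` IS OPEN** in `U(Φ₃)(L⁺_v)` (`v` non-split) — §2 with `V = T`. [cite: Rogawski1990, §12.5 p. 182] [cite: HarishChandra1970, Part I §3 Lemma 20] -/
theorem isOpen_hyperbolicSet (hns : ∀ w : PlacesOver L v, IsCMField.complexConj L • w.1 = w.1) :
    IsOpen (X := ↥(unitaryGroupOfForm (conjLocal L (IsCMField.complexConj L) v) (cmLocalForm L 3 v))) (hyperbolicSet L v) := by
  rw [isOpen_iff_mem_nhds]
  rintro γ₀ ⟨t₀, hreg₀, hconj⟩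
  obtain ⟨c, hc⟩ := isConj_iff.1 hconj
  have h := conj_regular_torus_nhds L v hns t₀ hreg₀ c (V := univ) univ_mem
  rw [hc] at h
  refine mem_of_superset h ?_
  rintro g ⟨x, s, -, hsreg, rfl⟩
  exact ⟨s, hsreg, isConj_iff.2 ⟨x, rfl⟩⟩

/-! ## §3 The recipe `N(x) = ψ(t_x)` (`x ∈ Ω`), `N(x) = 0` (`x ∉ Ω`): torus values, conjugation invariance, continuity on `Ω`, measurability, bounds on compacts -/

section Recipe

variable (hns : ∀ w : PlacesOver L v, IsCMField.complexConj L • w.1 = w.1)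
  (w₀ : ↥(unitaryGroupOfForm (conjLocal L (IsCMField.complexConj L) v) (cmLocalForm L 3 v)))
  (hw₀ : Units.val (w₀ : GL (Fin 3) (LocalRing L v)) = cmLocalForm L 3 v)
  (ψ : ↥(cmBorelTriple L 3 v).M → ℂ)
  (hψw : ∀ t : ↥(cmBorelTriple L 3 v).M,
    ψ ⟨w₀ * (t : ↥(unitaryGroupOfForm (conjLocal L (IsCMField.complexConj L) v) (cmLocalForm L 3 v))) * w₀⁻¹, weylConj_mem_cmTorus L v w₀ hw₀ t⟩ = ψ t)
  (N : ↥(unitaryGroupOfForm (conjLocal L (IsCMField.complexConj L) v) (cmLocalForm L 3 v)) → ℂ)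
  (hN : ∀ (x : ↥(unitaryGroupOfForm (conjLocal L (IsCMField.complexConj L) v) (cmLocalForm L 3 v))) (h : x ∈ (hyperbolicSet L v : Set ↥(unitaryGroupOfForm (conjLocal L (IsCMField.complexConj L) v) (cmLocalForm L 3 v)))), N x = ψ h.choose)
  (hN0 : ∀ x : ↥(unitaryGroupOfForm (conjLocal L (IsCMField.complexConj L) v) (cmLocalForm L 3 v)), x ∉ (hyperbolicSet L v : Set ↥(unitaryGroupOfForm (conjLocal L (IsCMField.complexConj L) v) (cmLocalForm L 3 v))) → N x = 0)

include hns hw₀ hψw hN in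
/-- **TORUS VALUES**: if `t ∈ T^{reg}` is conjugate to `x`, then `N x = ψ t` (the chosen torus conjugate of `x` is `t` or `ʷt`, §1, and `ψ` is `W`-symmetric).
[cite: Rogawski1990, §12.5 p. 182] [cite: HarishChandra1970, Lemma 42] -/
theorem apply_eq_of_isConj (t : ↥(cmBorelTriple L 3 v).M)
    (hreg : IsRegularElt (((t : ↥(unitaryGroupOfForm (conjLocal L (IsCMField.complexConj L) v) (cmLocalForm L 3 v))) : GL (Fin 3) (LocalRing L v))))
    (x : ↥(unitaryGroupOfForm (conjLocal L (IsCMField.complexConj L) v) (cmLocalForm L 3 v))) (hx : IsConj (t : ↥(unitaryGroupOfForm (conjLocal L (IsCMField.complexConj L) v) (cmLocalForm L 3 v))) x) :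
    N x = ψ t := by
  have h : x ∈ (hyperbolicSet L v : Set ↥(unitaryGroupOfForm (conjLocal L (IsCMField.complexConj L) v) (cmLocalForm L 3 v))) := ⟨t, hreg, hx⟩
  rw [hN x h]
  obtain ⟨hreg', hconj'⟩ := h.choose_spec
  -- the chosen `t′` is conjugate to `t`
  have htt' : IsConj (t : ↥(unitaryGroupOfForm (conjLocal L (IsCMField.complexConj L) v) (cmLocalForm L 3 v))) (h.choose : ↥(unitaryGroupOfForm (conjLocal L (IsCMField.complexConj L) v) (cmLocalForm L 3 v))) := hx.trans hconj'.symm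
  rcases eq_or_eq_weylConj_of_isConj L v hns w₀ hw₀ t.2 hreg h.choose.2 hreg' htt' with h1 | h2
  · rw [show h.choose = t from Subtype.ext h1]
  · rw [show h.choose = ⟨w₀ * (t : ↥(unitaryGroupOfForm (conjLocal L (IsCMField.complexConj L) v) (cmLocalForm L 3 v))) * w₀⁻¹,
      weylConj_mem_cmTorus L v w₀ hw₀ t⟩ from Subtype.ext h2, hψw]

include hns hw₀ hψw hN in
/-- **TORUS VALUES ON `T^{reg}`**: `N t = ψ t`. [cite: Rogawski1990, §12.5 p. 182] -/
theorem apply_coe_eq (t : ↥(cmBorelTriple L 3 v).M)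
    (hreg : IsRegularElt (((t : ↥(unitaryGroupOfForm (conjLocal L (IsCMField.complexConj L) v) (cmLocalForm L 3 v))) : GL (Fin 3) (LocalRing L v)))) :
    N (t : ↥(unitaryGroupOfForm (conjLocal L (IsCMField.complexConj L) v) (cmLocalForm L 3 v))) = ψ t :=
  apply_eq_of_isConj L v hns w₀ hw₀ ψ hψw N hN t hreg _ (IsConj.refl _)

include hns hw₀ hψw hN hN0 in
/-- **CONJUGATION INVARIANCE** (on all of `G`: both sides vanish off `Ω`, which is conjugation-saturated). [cite: Rogawski1990, §1.6 p. 6; §12.5 p. 182] -/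
theorem apply_conj_eq (x h : ↥(unitaryGroupOfForm (conjLocal L (IsCMField.complexConj L) v) (cmLocalForm L 3 v))) : N (h * x * h⁻¹) = N x := by
  by_cases hx : x ∈ (hyperbolicSet L v : Set ↥(unitaryGroupOfForm (conjLocal L (IsCMField.complexConj L) v) (cmLocalForm L 3 v)))
  · obtain ⟨t, hreg, hconj⟩ := hx
    rw [apply_eq_of_isConj L v hns w₀ hw₀ ψ hψw N hN t hreg x hconj,
      apply_eq_of_isConj L v hns w₀ hw₀ ψ hψw N hN t hreg (h * x * h⁻¹) (hconj.trans (isConj_iff.2 ⟨h, rfl⟩))]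
  · have hx' : h * x * h⁻¹ ∉ (hyperbolicSet L v : Set ↥(unitaryGroupOfForm (conjLocal L (IsCMField.complexConj L) v) (cmLocalForm L 3 v))) := by
      rintro ⟨t, hreg, hconj⟩
      exact hx ⟨t, hreg, hconj.trans (isConj_iff.2 ⟨h⁻¹, by group⟩)⟩
    rw [hN0 x hx, hN0 _ hx']

include hns hw₀ hψw hN in
/-- **CONTINUITY AT THE POINTS OF `Ω`** (`ψ` continuous): near `γ₀ = c t₀ c⁻¹` every element is `x s x⁻¹` with `s ∈ T^{reg}` close to `t₀` (§2), where `N = ψ(s)`.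
[cite: HarishChandra1970, Part I §3 Lemma 20; Part V §3 Thm. 12] [cite: Rogawski1990, §12.5 p. 182] -/
theorem continuousAt_of_mem (hψ : Continuous ψ) {γ₀ : ↥(unitaryGroupOfForm (conjLocal L (IsCMField.complexConj L) v) (cmLocalForm L 3 v))} (hγ₀ : γ₀ ∈ (hyperbolicSet L v : Set ↥(unitaryGroupOfForm (conjLocal L (IsCMField.complexConj L) v) (cmLocalForm L 3 v)))) : ContinuousAt N γ₀ := by
  obtain ⟨t₀, hreg₀, hconj⟩ := hγ₀
  obtain ⟨c, hc⟩ := isConj_iff.1 hconj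
  rw [ContinuousAt, tendsto_def]
  intro s hs
  rw [apply_eq_of_isConj L v hns w₀ hw₀ ψ hψw N hN t₀ hreg₀ γ₀ hconj] at hs
  have hV : ψ ⁻¹' s ∈ 𝓝 t₀ := hψ.continuousAt.preimage_mem_nhds hs
  have h := conj_regular_torus_nhds L v hns t₀ hreg₀ c hV
  rw [hc] at h
  refine mem_of_superset h ?_
  rintro g ⟨x, t, htV, htreg, rfl⟩
  show N _ ∈ s
  rw [apply_eq_of_isConj L v hns w₀ hw₀ ψ hψw N hN t htreg _ (isConj_iff.2 ⟨x, rfl⟩)]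
  exact htV

include hns hw₀ hψw hN hN0 in
/-- **MEASURABILITY** of the recipe (`ψ` continuous): `N` is continuous at every point of the OPEN set `Ω` and vanishes off it, so the preimage of an open `U` is
`{x ∈ Ω | N x ∈ U}` (open) together with `Ωᶜ` or `∅`. [cite: Rogawski1990, §1.6 p. 6; §12.5 p. 182] -/
theorem measurable_of_recipe [MeasurableSpace ↥(unitaryGroupOfForm (conjLocal L (IsCMField.complexConj L) v) (cmLocalForm L 3 v))] [BorelSpace ↥(unitaryGroupOfForm (conjLocal L (IsCMField.complexConj L) v) (cmLocalForm L 3 v))] (hψ : Continuous ψ) : Measurable N := by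
  have hΩ := isOpen_hyperbolicSet L v hns
  refine measurable_of_isOpen fun U hU => ?_
  have hA : IsOpen {x : ↥(unitaryGroupOfForm (conjLocal L (IsCMField.complexConj L) v) (cmLocalForm L 3 v)) | x ∈ (hyperbolicSet L v : Set ↥(unitaryGroupOfForm (conjLocal L (IsCMField.complexConj L) v) (cmLocalForm L 3 v))) ∧ N x ∈ U} := by
    rw [isOpen_iff_mem_nhds]
    rintro x ⟨hxΩ, hxU⟩
    have h1 : N ⁻¹' U ∈ 𝓝 x := (continuousAt_of_mem L v hns w₀ hw₀ ψ hψw N hN hψ hxΩ).preimage_mem_nhds (hU.mem_nhds hxU)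
    filter_upwards [h1, hΩ.mem_nhds hxΩ] with y hy hyΩ using ⟨hyΩ, hy⟩
  by_cases h0 : (0 : ℂ) ∈ U
  · have heq : N ⁻¹' U = {x : ↥(unitaryGroupOfForm (conjLocal L (IsCMField.complexConj L) v) (cmLocalForm L 3 v)) | x ∈ (hyperbolicSet L v : Set ↥(unitaryGroupOfForm (conjLocal L (IsCMField.complexConj L) v) (cmLocalForm L 3 v))) ∧ N x ∈ U} ∪ (hyperbolicSet L v : Set ↥(unitaryGroupOfForm (conjLocal L (IsCMField.complexConj L) v) (cmLocalForm L 3 v)))ᶜ := by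
      ext x
      simp only [mem_preimage, mem_union, mem_setOf_eq, mem_compl_iff]
      constructor
      · intro hx
        by_cases hxΩ : x ∈ (hyperbolicSet L v : Set ↥(unitaryGroupOfForm (conjLocal L (IsCMField.complexConj L) v) (cmLocalForm L 3 v)))
        · exact Or.inl ⟨hxΩ, hx⟩
        · exact Or.inr hxΩ
      · rintro (⟨-, hx⟩ | hx)
        · exact hx
        · rw [hN0 x hx]; exact h0
    rw [heq]
    exact hA.measurableSet.union hΩ.measurableSet.compl
  · have heq : N ⁻¹' U = {x : ↥(unitaryGroupOfForm (conjLocal L (IsCMField.complexConj L) v) (cmLocalForm L 3 v)) | x ∈ (hyperbolicSet L v : Set ↥(unitaryGroupOfForm (conjLocal L (IsCMField.complexConj L) v) (cmLocalForm L 3 v))) ∧ N x ∈ U} := by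
      ext x
      simp only [mem_preimage, mem_setOf_eq]
      constructor
      · intro hx
        by_cases hxΩ : x ∈ (hyperbolicSet L v : Set ↥(unitaryGroupOfForm (conjLocal L (IsCMField.complexConj L) v) (cmLocalForm L 3 v)))
        · exact ⟨hxΩ, hx⟩
        · exact absurd (by rwa [hN0 x hxΩ] at hx) h0
      · rintro ⟨-, hx⟩; exact hx
    rw [heq]
    exact hA.measurableSet

set_option maxHeartbeats 800000 in
include hns hw₀ hψw hN hN0 in
/-- **BOUNDED ON COMPACT SETS** (`ψ` continuous): for a compact `K ⊆ G` there is `B` with `‖N x‖ ≤ B` on `K`.  If `x = c t c⁻¹ ∈ K ∩ Ω` (`t ∈ T^{reg}`), write `c = κ b`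
(`κ ∈ K_v`, `b ∈ B`, ★ Iwasawa); then `b t b⁻¹ = κ⁻¹ x κ ∈ B ∩ K_v⁻¹ K K_v` (compact) and its Levi projection is `t` (★ `continuous_proj_borelTriple`), so the torus
parameters of the classes meeting `K` lie in a compact subset of `T`. [cite: HarishChandra1970, Part I §3 Lemma 19 (Cor.)] [cite: Rogawski1990, §4.9 p. 54] -/
theorem exists_bound_of_isCompact (hψ : Continuous ψ) {K : Set ↥(unitaryGroupOfForm (conjLocal L (IsCMField.complexConj L) v) (cmLocalForm L 3 v))} (hK : IsCompact K) : ∃ B : ℝ, ∀ x ∈ K, ‖N x‖ ≤ B := by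
  -- the compact `K_v`, the compact `K′ = {κ⁻¹ x κ}`, its trace on `B`, the compact set of Levi projections
  obtain ⟨KU, hKU⟩ : ∃ KU : Subgroup ↥(unitaryGroupOfForm (conjLocal L (IsCMField.complexConj L) v) (cmLocalForm L 3 v)),
      KU = cmLocalIntegralLevel L 3 (Matrix.of fun i j : Fin 3 => if i.val + j.val + 1 = 3 then (1 : L) else 0) v := ⟨_, rfl⟩
  obtain ⟨K₁, hK₁⟩ : ∃ K₁ : Set ↥(unitaryGroupOfForm (conjLocal L (IsCMField.complexConj L) v) (cmLocalForm L 3 v)), K₁ = (KU : Set ↥(unitaryGroupOfForm (conjLocal L (IsCMField.complexConj L) v) (cmLocalForm L 3 v))) := ⟨_, rfl⟩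
  have hK₁c : IsCompact K₁ := by
    rw [hK₁, hKU]; exact (isCompact_isOpen_cmLocalIntegralLevel L 3 (Matrix.of fun i j : Fin 3 => if i.val + j.val + 1 = 3 then (1 : L) else 0) v).1
  have hK'c : IsCompact ((fun p : ↥(unitaryGroupOfForm (conjLocal L (IsCMField.complexConj L) v) (cmLocalForm L 3 v)) × ↥(unitaryGroupOfForm (conjLocal L (IsCMField.complexConj L) v) (cmLocalForm L 3 v)) => p.1⁻¹ * p.2 * p.1) '' (K₁ ×ˢ K)) :=
    (hK₁c.prod hK).image (by fun_prop)
  have hPcl : IsClosed (((cmBorelTriple L 3 v).P : Subgroup ↥(unitaryGroupOfForm (conjLocal L (IsCMField.complexConj L) v) (cmLocalForm L 3 v))) :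
      Set ↥(unitaryGroupOfForm (conjLocal L (IsCMField.complexConj L) v) (cmLocalForm L 3 v))) :=
    isClosed_borelU (conjLocal L (IsCMField.complexConj L) v) (cmLocalForm L 3 v)
  have hSc : IsCompact {b : ↥(cmBorelTriple L 3 v).P |
      (b : ↥(unitaryGroupOfForm (conjLocal L (IsCMField.complexConj L) v) (cmLocalForm L 3 v))) ∈
        (fun p : ↥(unitaryGroupOfForm (conjLocal L (IsCMField.complexConj L) v) (cmLocalForm L 3 v)) × ↥(unitaryGroupOfForm (conjLocal L (IsCMField.complexConj L) v) (cmLocalForm L 3 v)) => p.1⁻¹ * p.2 * p.1) '' (K₁ ×ˢ K)} :=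
    hPcl.isClosedEmbedding_subtypeVal.isCompact_preimage hK'c
  have hAc : IsCompact ((cmBorelTriple L 3 v).proj '' {b : ↥(cmBorelTriple L 3 v).P |
      (b : ↥(unitaryGroupOfForm (conjLocal L (IsCMField.complexConj L) v) (cmLocalForm L 3 v))) ∈
        (fun p : ↥(unitaryGroupOfForm (conjLocal L (IsCMField.complexConj L) v) (cmLocalForm L 3 v)) × ↥(unitaryGroupOfForm (conjLocal L (IsCMField.complexConj L) v) (cmLocalForm L 3 v)) => p.1⁻¹ * p.2 * p.1) '' (K₁ ×ˢ K)}) :=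
    hSc.image (continuous_proj_borelTriple (conjLocal L (IsCMField.complexConj L) v) (cmLocalForm L 3 v) (cmLocalForm_eq_over L 3 v))
  obtain ⟨B, hB⟩ := (hAc.image hψ).isBounded.exists_norm_le
  refine ⟨max B 0, fun x hx => ?_⟩
  by_cases hxΩ : x ∈ (hyperbolicSet L v : Set ↥(unitaryGroupOfForm (conjLocal L (IsCMField.complexConj L) v) (cmLocalForm L 3 v)))
  · obtain ⟨t, hreg, hconj⟩ := hxΩ
    obtain ⟨c, hc⟩ := isConj_iff.1 hconj
    rw [apply_eq_of_isConj L v hns w₀ hw₀ ψ hψw N hN t hreg x hconj]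
    refine le_trans (hB _ ⟨t, ?_, rfl⟩) (le_max_left _ _)
    -- Iwasawa: `c = κ b`; the element `p = b t b⁻¹ ∈ B`
    obtain ⟨κ, hκ, b, hcb⟩ := exists_mem_cmLocalIntegralLevel_mul_borel L 3 v c
    obtain ⟨tP, htP⟩ : ∃ tP : ↥(cmBorelTriple L 3 v).P, (tP : ↥(unitaryGroupOfForm (conjLocal L (IsCMField.complexConj L) v) (cmLocalForm L 3 v))) = (t : ↥(unitaryGroupOfForm (conjLocal L (IsCMField.complexConj L) v) (cmLocalForm L 3 v))) :=
      ⟨⟨(t : ↥(unitaryGroupOfForm (conjLocal L (IsCMField.complexConj L) v) (cmLocalForm L 3 v))), (cmBorelTriple L 3 v).M_le t.2⟩, rfl⟩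
    obtain ⟨bb, hbb⟩ : ∃ bb : ↥(unitaryGroupOfForm (conjLocal L (IsCMField.complexConj L) v) (cmLocalForm L 3 v)), bb = (b : ↥(unitaryGroupOfForm (conjLocal L (IsCMField.complexConj L) v) (cmLocalForm L 3 v))) := ⟨_, rfl⟩
    obtain ⟨tt, htt⟩ : ∃ tt : ↥(unitaryGroupOfForm (conjLocal L (IsCMField.complexConj L) v) (cmLocalForm L 3 v)), tt = (t : ↥(unitaryGroupOfForm (conjLocal L (IsCMField.complexConj L) v) (cmLocalForm L 3 v))) := ⟨_, rfl⟩
    have hpval : ((b * tP * b⁻¹ : ↥(cmBorelTriple L 3 v).P) : ↥(unitaryGroupOfForm (conjLocal L (IsCMField.complexConj L) v) (cmLocalForm L 3 v))) = bb * tt * bb⁻¹ := by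
      rw [Subgroup.coe_mul, Subgroup.coe_mul, Subgroup.coe_inv, htP, hbb, htt]
    have hgoal : κ⁻¹ * x * κ = bb * tt * bb⁻¹ := by
      rw [← hc, hcb, ← hbb, ← htt]
      simp only [mul_inv_rev, mul_assoc, inv_mul_cancel_left, inv_mul_cancel, mul_one]
    refine ⟨b * tP * b⁻¹, ?_, ?_⟩
    · -- `b t b⁻¹ = κ⁻¹ x κ ∈ K′`
      refine ⟨(κ, x), ⟨by rw [hK₁, hKU]; exact hκ, hx⟩, ?_⟩
      exact hgoal.trans hpval.symm
    · -- its Levi projection is `t`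
      have hcomm : (cmBorelTriple L 3 v).proj b * t = t * (cmBorelTriple L 3 v).proj b :=
        Subtype.ext (mul_comm_of_mem_torusU_cmLocal L v ((cmBorelTriple L 3 v).proj b).2 t.2)
      have hpt : (cmBorelTriple L 3 v).proj tP = t :=
        Subtype.ext (((cmBorelTriple L 3 v).proj_apply_of_mem_M tP (htP ▸ t.2)).trans htP)
      rw [map_mul, map_mul, hpt, hcomm, mul_assoc, ← map_mul, mul_inv_cancel, map_one, mul_one]
  · rw [hN0 x hxΩ, norm_zero]
    exact le_max_right _ _

end Recipe

/-! ## §4 The package -/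

open scoped Classical in
/-- **CLASS FUNCTIONS ON THE HYPERBOLIC SET FROM `W`-SYMMETRIC TORUS FUNCTIONS.**  Let `v` be non-split, `w₀ ∈ G = U(Φ₃)(L⁺_v)` the element with matrix `Φ₃`, and
`ψ : T → ℂ` a CONTINUOUS function on the split torus with `ψ(ʷt) = ψ(t)`.  Then there is `N : G → ℂ` which is MEASURABLE, CONJUGATION INVARIANT, vanishes off the regular
hyperbolic set `Ω = hyperbolicSet L v`, equals `ψ` on `T^{reg}`, and is BOUNDED ON EVERY COMPACT SET.  (Witness: `N x = ψ(t_x)` for `x ∈ Ω`, §3.)  With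
`ψ = χ + χ ∘ ʷ` and the factor `|D_G|^{−1∕2}` this is the character `Θ_χ` of the principal series `i_G(χ)` [Rogawski1990, §12.5; (4.9.4)]; with `ψ` the torus values of any
admissible character it is the shape of Harish-Chandra's Theorem 12 («there exists a locally constant function `F` on `G′` such that `Θ_π = F` on `G′`», built from `F_Γ` on the
Cartan subgroup). [cite: Rogawski1990, §12.5 p. 182; §4.9 (4.9.4) p. 56; §1.6 p. 6] [cite: HarishChandra1970, Part V §3 Thm. 12; Part I §3 Lemmas 19–20; Lemma 42]
[cite: vanDijk1972, §2, Thm. p. 237] -/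
theorem exists_hyperbolicClassFun (hns : ∀ w : PlacesOver L v, IsCMField.complexConj L • w.1 = w.1)
    [MeasurableSpace ↥(unitaryGroupOfForm (conjLocal L (IsCMField.complexConj L) v) (cmLocalForm L 3 v))] [BorelSpace ↥(unitaryGroupOfForm (conjLocal L (IsCMField.complexConj L) v) (cmLocalForm L 3 v))]
    (w₀ : ↥(unitaryGroupOfForm (conjLocal L (IsCMField.complexConj L) v) (cmLocalForm L 3 v)))
    (hw₀ : Units.val (w₀ : GL (Fin 3) (LocalRing L v)) = cmLocalForm L 3 v)
    (ψ : ↥(cmBorelTriple L 3 v).M → ℂ) (hψ : Continuous ψ)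
    (hψw : ∀ t : ↥(cmBorelTriple L 3 v).M,
      ψ ⟨w₀ * (t : ↥(unitaryGroupOfForm (conjLocal L (IsCMField.complexConj L) v) (cmLocalForm L 3 v))) * w₀⁻¹, weylConj_mem_cmTorus L v w₀ hw₀ t⟩ = ψ t) :
    ∃ N : ↥(unitaryGroupOfForm (conjLocal L (IsCMField.complexConj L) v) (cmLocalForm L 3 v)) → ℂ, Measurable N ∧
      (∀ x : ↥(unitaryGroupOfForm (conjLocal L (IsCMField.complexConj L) v) (cmLocalForm L 3 v)), x ∈ (hyperbolicSet L v : Set ↥(unitaryGroupOfForm (conjLocal L (IsCMField.complexConj L) v) (cmLocalForm L 3 v))) → ∀ h : ↥(unitaryGroupOfForm (conjLocal L (IsCMField.complexConj L) v) (cmLocalForm L 3 v)), N (h * x * h⁻¹) = N x) ∧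
      (∀ x : ↥(unitaryGroupOfForm (conjLocal L (IsCMField.complexConj L) v) (cmLocalForm L 3 v)), x ∉ (hyperbolicSet L v : Set ↥(unitaryGroupOfForm (conjLocal L (IsCMField.complexConj L) v) (cmLocalForm L 3 v))) → N x = 0) ∧
      (∀ t : ↥(cmBorelTriple L 3 v).M,
        IsRegularElt (((t : ↥(unitaryGroupOfForm (conjLocal L (IsCMField.complexConj L) v) (cmLocalForm L 3 v))) : GL (Fin 3) (LocalRing L v))) →
          N (t : ↥(unitaryGroupOfForm (conjLocal L (IsCMField.complexConj L) v) (cmLocalForm L 3 v))) = ψ t) ∧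
      (∀ K : Set ↥(unitaryGroupOfForm (conjLocal L (IsCMField.complexConj L) v) (cmLocalForm L 3 v)), IsCompact K → ∃ B : ℝ, ∀ x ∈ K, ‖N x‖ ≤ B) := by
  let N : ↥(unitaryGroupOfForm (conjLocal L (IsCMField.complexConj L) v) (cmLocalForm L 3 v)) → ℂ := fun x => if h : x ∈ (hyperbolicSet L v : Set ↥(unitaryGroupOfForm (conjLocal L (IsCMField.complexConj L) v) (cmLocalForm L 3 v))) then ψ h.choose else 0
  have hN : ∀ (x : ↥(unitaryGroupOfForm (conjLocal L (IsCMField.complexConj L) v) (cmLocalForm L 3 v))) (h : x ∈ (hyperbolicSet L v : Set ↥(unitaryGroupOfForm (conjLocal L (IsCMField.complexConj L) v) (cmLocalForm L 3 v)))), N x = ψ h.choose := fun x h => dif_pos h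
  have hN0 : ∀ x : ↥(unitaryGroupOfForm (conjLocal L (IsCMField.complexConj L) v) (cmLocalForm L 3 v)), x ∉ (hyperbolicSet L v : Set ↥(unitaryGroupOfForm (conjLocal L (IsCMField.complexConj L) v) (cmLocalForm L 3 v))) → N x = 0 := fun x h => dif_neg h
  exact ⟨N, measurable_of_recipe L v hns w₀ hw₀ ψ hψw N hN hN0 hψ,
    fun x _ h => apply_conj_eq L v hns w₀ hw₀ ψ hψw N hN hN0 x h, hN0,
    fun t ht => apply_coe_eq L v hns w₀ hw₀ ψ hψw N hN t ht,
    fun K hK => exists_bound_of_isCompact L v hns w₀ hw₀ ψ hψw N hN hN0 hψ hK⟩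

end Summit.HodgeConjecture.HodgeConjecture.Cruxes.H413.K2E3HyperbolicClassFunOfTorus

end
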